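import Summits.Ventures.Crystal3D.Theorems.StickyWulffConstantGenericWallFloorHRowWalk
import Summits.Ventures.Crystal3D.Theorems.StickyWulffConstantGenericWallFloorBarlowRowBottomFamily
import Summits.Ventures.Crystal3D.Theorems.StickyWulffConstantGenericWallFloorBarlowTopFamily
import Summits.Ventures.Crystal3D.Theorems.StickyWulffConstantTextureLiminfTexShadowFluxPairSteerCore
import HarnessLib

/-!
# The h-LAYER ROW RUN in the wall cell: visited balls, «a payer is never deep inside a plate», and the END IS NOT HIGH
# (crux `GenericWallFloor`, stmt-Ventures-19480, kernel G; line «LAYER ROWS» of cf-p1 (ccix)/(ccx), R1 h-layer half; sequel of `…HRowWalk` p715926)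

HONEST FRAMING. Venture `Summits/Ventures/Crystal3D` (cell `crystal3d-full`), route `route-Ventures-StickyWulffConstant`, helper for the crux
`GenericWallFloor` (stmt-Ventures-19480) / consumer `TextureLiminfV5` (stmt-Ventures-23912).  Elementary bookkeeping on top of the landed sealing /
window-completeness / star-rigidity lemmas; standard axioms; the A12-583 certificate stays a named hypothesis of `hRow_end`; F-C1 not moved.

THE POINT.  For the one-family count of the LAYER ROWS line the END of every h-row walker must lie in the payer window `PAY = {deg ≠ 12, −R₀−2 ≤ y₂ ≤ h+R₀+2}`.
* `hRowRun_prefix` — along the run every visited ball is in `X` and every NON-FINAL visited ball is h-FULL (all twelve `y + F·hcpSlots` occupied);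
* **`not_deep_of_card_le_eleven`** — a ball of `X` with `≤ 11` contacts off the rim is NEVER at depth `≥ 1` inside a clamped complete plate window (sealing
  `stacking_sealing_above` + `barlowWindow_complete_gen` + `twelve_le_card_contacts_of_complete_site`) — for ANY walker, no apartness;
* **`frame_of_hFull_deep`** — an h-full ball deep inside plate 2's window forces `F·Λ₀ ∈ {L₂·Λ₀, twin}` (the three upper slots are independent:
  `barlow_frame_eq_or_eq_twin`) — this is where clause (i) (`hapart`) bites;
* **`hRow_end_not_high`** — under `hapart : F·Λ₀ ≠ L₂·Λ₀ ∧ F·Λ₀ ≠ twin(L₂)·Λ₀`, an h-row started below `h+R₀+1` off the rim ends BELOW `h+R₀+1`: either the end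
  would be a deep payer (impossible) or the walker tunnelled through plate 2's deep region on h-full balls (impossible by `frame_of_hFull_deep`);
* `hRow_end_not_low` — an end at or above its start is not at depth `≥ 1` in plate 1 either (same payer lemma), so it is `> −R₀ − 1`.
WHAT THIS IS NOT: no family / injectivity / line count (next file), no certificate; F-C1 not moved.
-/

noncomputable section

namespace Summit.Ventures.Crystal3D.Theorems

open Finset
open Literature.MathematicalPhysics.StatisticalMechanics
open Summit.Ventures.Crystal3D.Cruxes.TextureLiminf.TexShadow (stacking upSlot₁ upSlot₂ upSlot₃ inner_upSlot_upSlot upSlots_ne)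
open scoped InnerProductSpace

variable {X : Finset (EuclideanSpace ℝ (Fin 3))}

/-! ### Visited balls of an h-row -/

/-- **The run's prefix**: from a state with `HRowInv`, after `k` units of fuel the walker sits at `y + n • F u` (`n ≤ k`) with `HRowInv`; every visited ball
`y + m • F u` (`m ≤ n`) is in `X`, every non-final one (`m < n`) is h-FULL; and either all the fuel was used (`n = k`) or the walk has stopped. -/
theorem hRowRun_prefix {F : EuclideanSpace ℝ (Fin 3) ≃ₗᵢ[ℝ] EuclideanSpace ℝ (Fin 3)} {u : EuclideanSpace ℝ (Fin 3)}
    (hu : u ∈ fccSlots) (hu2 : u 2 = 0) (k : ℕ) {y : EuclideanSpace ℝ (Fin 3)} (hI : HRowInv X F u y) :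
    ∃ n : ℕ, n ≤ k ∧ hRowRun X F u k y = y + (n : ℝ) • F u ∧ HRowInv X F u (hRowRun X F u k y) ∧
      (∀ m : ℕ, m ≤ n → y + (m : ℝ) • F u ∈ X) ∧
      (∀ m : ℕ, m < n → ∀ w ∈ hcpSlots, y + (m : ℝ) • F u + F w ∈ X) ∧
      (n = k ∨ hRowStep X F u (hRowRun X F u k y) = none) := by
  induction k generalizing y with
  | zero =>
    refine ⟨0, le_rfl, by simp, hI, fun m hm => ?_, fun m hm => absurd hm (Nat.not_lt_zero m), Or.inl rfl⟩
    obtain rfl : m = 0 := Nat.le_zero.1 hm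
    simpa using hI.1
  | succ k IH =>
    by_cases hfull : ∀ w ∈ hcpSlots, y + F w ∈ X
    · obtain ⟨n, hn, hrun, hInv, hvis, hpre, hend⟩ := IH (hRowInv_step hu hu2 hI hfull)
      refine ⟨n + 1, by omega, ?_, ?_, fun m hm => ?_, fun m hm w hw => ?_, ?_⟩
      · rw [hRowRun_succ_of_full F hfull, hrun, Nat.cast_succ, add_smul, one_smul]; abel
      · rw [hRowRun_succ_of_full F hfull]; exact hInv
      · rcases Nat.eq_zero_or_pos m with rfl | hm0
        · simpa using hI.1
        · obtain ⟨m', rfl⟩ : ∃ m', m = m' + 1 := ⟨m - 1, by omega⟩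
          have := hvis m' (by omega)
          rw [Nat.cast_succ, add_smul, one_smul]
          convert this using 1; abel
      · rcases Nat.eq_zero_or_pos m with rfl | hm0
        · simpa using hfull w hw
        · obtain ⟨m', rfl⟩ : ∃ m', m = m' + 1 := ⟨m - 1, by omega⟩
          have := hpre m' (by omega) w hw
          rw [Nat.cast_succ, add_smul, one_smul]
          convert this using 1; abel
      · rw [hRowRun_succ_of_full F hfull]
        rcases hend with h | h
        · exact Or.inl (by omega)
        · exact Or.inr h
    · have hnone := hRowStep_of_not_full F hfull (u := u)
      refine ⟨0, Nat.zero_le _, ?_, ?_, fun m hm => ?_, fun m hm => absurd hm (Nat.not_lt_zero m), Or.inr ?_⟩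
      · rw [hRowRun_of_none F hnone]; simp
      · rw [hRowRun_of_none F hnone]; exact hI
      · obtain rfl : m = 0 := Nat.le_zero.1 hm
        simpa using hI.1
      · rw [hRowRun_of_none F hnone]; exact hnone

/-- Height of a visited ball: `(y + m • F u)₂ = y₂ + m·(F u)₂` (coordinate form; cf. `apply_two_add_smul` of …PlateFoot). -/
theorem hRow_height_add_smul (y v : EuclideanSpace ℝ (Fin 3)) (m : ℝ) : (y + m • v) 2 = y 2 + m * v 2 := by
  rw [PiLp.add_apply, PiLp.smul_apply, smul_eq_mul]

/-- Lateral radius of a visited ball: at most the start's plus the number of unit steps. -/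
theorem sqrt_lateral_add_smul_le (y v : EuclideanSpace ℝ (Fin 3)) (hv : ‖v‖ = 1) {m : ℝ} (hm : 0 ≤ m) :
    Real.sqrt ((y + m • v) 0 ^ 2 + (y + m • v) 1 ^ 2) ≤ Real.sqrt (y 0 ^ 2 + y 1 ^ 2) + m := by
  have h := sqrt_lateral_add_le y (m • v)
  rw [norm_smul, hv, mul_one, Real.norm_eq_abs, abs_of_nonneg hm] at h
  exact h

/-! ### A payer is never deep inside a complete clamped plate -/

/-- **A ball with at most eleven contacts is not at depth `≥ 1` inside a clamped complete plate window.**  `X` `1`-separated, `P ⊆ X` the complete sample of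
`stacking L s σ` in the window `[lo, hi] × {lateral² ≤ ρ²}` (`ρ ≥ 2`); `y ∈ X` with `≤ 11` contacts and lateral² `≤ (ρ−2)²`: then NOT `lo + 1 ≤ y₂ ≤ hi − 1`. -/
theorem not_deep_of_card_le_eleven (hX : ∀ p ∈ X, ∀ q ∈ X, p ≠ q → 1 ≤ dist p q)
    {σ : ℤ → ℤ} (hσ : IsHaggSeq σ) (L : EuclideanSpace ℝ (Fin 3) ≃ₗᵢ[ℝ] EuclideanSpace ℝ (Fin 3)) (s : EuclideanSpace ℝ (Fin 3))
    (lo hi ρ : ℝ) (hρ : 2 ≤ ρ) (P : Finset (EuclideanSpace ℝ (Fin 3))) (hPX : P ⊆ X)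
    (hP : ∀ p, p ∈ P ↔ (p ∈ stacking L s σ ∧ lo ≤ p 2 ∧ p 2 ≤ hi ∧ p 0 ^ 2 + p 1 ^ 2 ≤ ρ ^ 2))
    {y : EuclideanSpace ℝ (Fin 3)} (hy : y ∈ X) (hdeg : (X.filter fun q => dist y q = 1).card ≤ 11)
    (hlat : y 0 ^ 2 + y 1 ^ 2 ≤ (ρ - 2) ^ 2) : ¬ (lo + 1 ≤ y 2 ∧ y 2 ≤ hi - 1) := by
  rintro ⟨hlo, hhi⟩
  have hρ1 : 1 ≤ ρ := by linarith
  have hlat1 : y 0 ^ 2 + y 1 ^ 2 ≤ (ρ - 1) ^ 2 := hlat.trans (by nlinarith)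
  -- `y` is a site of the stacking (sealing)
  have hyP : y ∈ P := by
    by_contra hyP
    exact stacking_sealing_above hσ L s lo hi ρ hρ1 X P hX hPX hP y hy hyP hlo (by linarith) hlat1
  obtain ⟨hyS, -, -, -⟩ := (hP y).1 hyP
  obtain ⟨p, hp, hpy⟩ := hyS
  obtain ⟨m, a, b, rfl⟩ := hp
  dsimp only at hpy
  -- its twelve stacking neighbours are in the window, hence occupied
  have hcomp := barlowWindow_complete_gen (X := X) L s lo hi ρ hρ1 P hPX hP m a b (by rw [hpy]; exact hlo) (by rw [hpy]; exact hhi)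
    (by rw [hpy]; exact hlat1)
  have h12 := twelve_le_card_contacts_of_complete_site (X := X) hσ L s m a b hcomp
  rw [hpy] at h12
  omega

/-! ### An h-full ball deep inside plate 2 pins the frame -/

/-- The three upper slots are h-slots, fcc slots, and linearly independent. -/
theorem upSlots_hcp_independent :
    (upSlot₁ ∈ hcpSlots ∧ upSlot₂ ∈ hcpSlots ∧ upSlot₃ ∈ hcpSlots) ∧
      (upSlot₁ ∈ fccSlots ∧ upSlot₂ ∈ fccSlots ∧ upSlot₃ ∈ fccSlots) ∧ LinearIndependent ℝ ![upSlot₁, upSlot₂, upSlot₃] := by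
  obtain ⟨h1, h2, h3⟩ := upSlots_mem_fccSlots
  obtain ⟨n12, n13, n23⟩ := upSlots_ne
  have hz : ∀ {w : EuclideanSpace ℝ (Fin 3)}, (w = upSlot₁ ∨ w = upSlot₂ ∨ w = upSlot₃) → 0 ≤ w 2 := by
    intro w hw
    rcases hw with rfl | rfl | rfl <;> simp [upSlot₁, upSlot₂, upSlot₃, barlowPos_apply_two] <;> positivity
  refine ⟨⟨mem_hcpSlots_of_upper h1 (hz (Or.inl rfl)), mem_hcpSlots_of_upper h2 (hz (Or.inr (Or.inl rfl))),
    mem_hcpSlots_of_upper h3 (hz (Or.inr (Or.inr rfl)))⟩, ⟨h1, h2, h3⟩, ?_⟩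
  refine linearIndependent_of_pairwise_half h1 h2 h3 ?_ ?_ ?_
  · rw [inner_upSlot_upSlot (Or.inl rfl) (Or.inr (Or.inl rfl)), if_neg n12]
  · rw [inner_upSlot_upSlot (Or.inl rfl) (Or.inr (Or.inr rfl)), if_neg n13]
  · rw [inner_upSlot_upSlot (Or.inr (Or.inl rfl)) (Or.inr (Or.inr rfl)), if_neg n23]

/-- **An h-FULL ball deep inside the clamped top plate pins the frame**: `X` `1`-separated, `P₂ ⊆ X` the complete sample of `stacking L₂ s₂ σ₂` in
`[h+R₀, h+2R₀] × {lateral² ≤ ρ²}`; `w ∈ X` with all twelve `w + F·hcpSlots` in `X`, heights `h+R₀+2 ≤ w₂ ≤ h+2R₀−1`, lateral radius `≤ ρ − 3`: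
then `F·Λ₀ = L₂·Λ₀` or `F·Λ₀ = twin(L₂)·Λ₀`. -/
theorem frame_of_hFull_deep (hX : ∀ p ∈ X, ∀ q ∈ X, p ≠ q → 1 ≤ dist p q)
    {σ₂ : ℤ → ℤ} (hσ₂ : IsHaggSeq σ₂) (L₂ : EuclideanSpace ℝ (Fin 3) ≃ₗᵢ[ℝ] EuclideanSpace ℝ (Fin 3)) (s₂ : EuclideanSpace ℝ (Fin 3))
    (R₀ h ρ : ℝ) (hρ : 3 ≤ ρ) (P₂ : Finset (EuclideanSpace ℝ (Fin 3))) (hP₂X : P₂ ⊆ X)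
    (hP₂ : ∀ p, p ∈ P₂ ↔ (p ∈ stacking L₂ s₂ σ₂ ∧ h + R₀ ≤ p 2 ∧ p 2 ≤ h + 2 * R₀ ∧ p 0 ^ 2 + p 1 ^ 2 ≤ ρ ^ 2))
    (F : EuclideanSpace ℝ (Fin 3) ≃ₗᵢ[ℝ] EuclideanSpace ℝ (Fin 3)) {w : EuclideanSpace ℝ (Fin 3)} (hw : w ∈ X)
    (hfull : ∀ s ∈ hcpSlots, w + F s ∈ X) (hw2 : h + R₀ + 2 ≤ w 2) (hw2' : w 2 ≤ h + 2 * R₀ - 1)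
    (hwr : Real.sqrt (w 0 ^ 2 + w 1 ^ 2) ≤ ρ - 3) :
    F '' fccStacking 1 (Real.sqrt (2 / 3)) = L₂ '' fccStacking 1 (Real.sqrt (2 / 3)) ∨
      F '' fccStacking 1 (Real.sqrt (2 / 3)) =
        (twinFrame L₂ (L₂ (EuclideanSpace.single (2 : Fin 3) (1 : ℝ)))) '' fccStacking 1 (Real.sqrt (2 / 3)) := by
  have hρ1 : 1 ≤ ρ := by linarith
  have hρ3 : 0 ≤ ρ - 3 := by linarith
  -- sealing: every ball of `X` at height in `[h+R₀+1, h+2R₀]` with lateral² ≤ (ρ−1)² is a site of plate 2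
  have hseal : ∀ q ∈ X, h + R₀ + 1 ≤ q 2 → q 2 ≤ h + 2 * R₀ → q 0 ^ 2 + q 1 ^ 2 ≤ (ρ - 1) ^ 2 → q ∈ stacking L₂ s₂ σ₂ := by
    intro q hq h1 h2 h3
    by_cases hqP : q ∈ P₂
    · exact ((hP₂ q).1 hqP).1
    · exact (stacking_sealing_above hσ₂ L₂ s₂ (h + R₀) (h + 2 * R₀) ρ hρ1 X P₂ hX hP₂X hP₂ q hq hqP (by linarith) h2 h3).elim
  have hwlat2 : w 0 ^ 2 + w 1 ^ 2 ≤ (ρ - 3) ^ 2 := by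
    have h0 : 0 ≤ w 0 ^ 2 + w 1 ^ 2 := by positivity
    have := pow_le_pow_left₀ (Real.sqrt_nonneg _) hwr 2
    rwa [Real.sq_sqrt h0] at this
  have hwS : w ∈ stacking L₂ s₂ σ₂ := hseal w hw (by linarith) (by linarith) (hwlat2.trans (by nlinarith))
  -- the three upper-slot neighbours are sites too
  have nbS : ∀ {s : EuclideanSpace ℝ (Fin 3)}, s ∈ hcpSlots → w + F s ∈ stacking L₂ s₂ σ₂ := by
    intro s hs
    have hn1 : ‖F s‖ = 1 := by rw [LinearIsometryEquiv.norm_map, norm_eq_one_of_mem_hcpSlots hs]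
    have hdist : dist (w + F s) w ≤ 1 := by rw [dist_eq_norm, add_sub_cancel_left, hn1]
    have h2abs := abs_apply_sub_le_dist (w + F s) w 2
    rw [dist_eq_norm, add_sub_cancel_left, hn1] at h2abs
    obtain ⟨hlo2, hhi2⟩ := abs_le.1 h2abs
    refine hseal _ (hfull s hs) (by linarith) (by linarith) ?_
    have hl := lateral_sq_add_le w (F s) (by linarith : (0 : ℝ) ≤ ρ - 3) hwlat2
    rw [hn1] at hl
    calc (w + F s) 0 ^ 2 + (w + F s) 1 ^ 2 ≤ (ρ - 3 + 1) ^ 2 := hl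
      _ ≤ (ρ - 1) ^ 2 := by nlinarith
  obtain ⟨⟨hh1, hh2, hh3⟩, ⟨hf1, hf2, hf3⟩, hind⟩ := upSlots_hcp_independent
  exact barlow_frame_eq_or_eq_twin hσ₂ L₂ s₂ F hwS hf1 hf2 hf3 hind (nbS hh1) (nbS hh2) (nbS hh3)

/-! ### The end of an h-row is not high -/

/-- **THE END OF AN h-ROW IS NOT HIGH.**  Cell: `X` `1`-separated inside the heights `[−2R₀, h+2R₀]`, `P₂` the complete clamped top plate (`R₀ ≥ 4`).
h-row data: in-plane slot `u`, frame `F` APART from plate 2 (`F·Λ₀ ≠ L₂·Λ₀`, `≠ twin`), rise `(F u)₂ ≥ 3/4`, `HRowInv` at the start `y` with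
`y₂ < h + R₀ + 1` and lateral radius `+ (4/3)(h + 4R₀) + 4 ≤ ρ`; the A12-583 certificate at the balls.  Then with fuel `N`, `(3/4)·N > h + 2R₀ − y₂`, the run
ends at a ball of height `< h + R₀ + 1`. -/
theorem hRow_end_not_high (hX : ∀ p ∈ X, ∀ q ∈ X, p ≠ q → 1 ≤ dist p q)
    {σ₂ : ℤ → ℤ} (hσ₂ : IsHaggSeq σ₂) (L₂ : EuclideanSpace ℝ (Fin 3) ≃ₗᵢ[ℝ] EuclideanSpace ℝ (Fin 3)) (s₂ : EuclideanSpace ℝ (Fin 3))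
    (R₀ h ρ : ℝ) (hR₀ : 4 ≤ R₀) (hh : 0 ≤ h) (P₂ : Finset (EuclideanSpace ℝ (Fin 3))) (hP₂X : P₂ ⊆ X)
    (hcell : ∀ p ∈ X, -(2 * R₀) ≤ p 2 ∧ p 2 ≤ h + 2 * R₀ ∧ p 0 ^ 2 + p 1 ^ 2 ≤ ρ ^ 2)
    (hP₂ : ∀ p, p ∈ P₂ ↔ (p ∈ stacking L₂ s₂ σ₂ ∧ h + R₀ ≤ p 2 ∧ p 2 ≤ h + 2 * R₀ ∧ p 0 ^ 2 + p 1 ^ 2 ≤ ρ ^ 2))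
    {F : EuclideanSpace ℝ (Fin 3) ≃ₗᵢ[ℝ] EuclideanSpace ℝ (Fin 3)} {u : EuclideanSpace ℝ (Fin 3)} (hu : u ∈ fccSlots) (hu2 : u 2 = 0)
    (hapart : F '' fccStacking 1 (Real.sqrt (2 / 3)) ≠ L₂ '' fccStacking 1 (Real.sqrt (2 / 3)) ∧
      F '' fccStacking 1 (Real.sqrt (2 / 3)) ≠
        (twinFrame L₂ (L₂ (EuclideanSpace.single (2 : Fin 3) (1 : ℝ)))) '' fccStacking 1 (Real.sqrt (2 / 3)))
    (hrise : (3 / 4 : ℝ) ≤ (F u) 2) (hcert : HStarCertifiedAt F u)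
    {y : EuclideanSpace ℝ (Fin 3)} (hI : HRowInv X F u y) (hylow : y 2 < h + R₀ + 1)
    (hylat : Real.sqrt (y 0 ^ 2 + y 1 ^ 2) + 4 / 3 * (h + 4 * R₀) + 4 ≤ ρ)
    {N : ℕ} (hN : h + 2 * R₀ - y 2 < 3 / 4 * N) :
    (hRowRun X F u N y) 2 < h + R₀ + 1 := by
  classical
  have he₃i : ∀ d : EuclideanSpace ℝ (Fin 3), ⟪d, EuclideanSpace.single (2 : Fin 3) (1 : ℝ)⟫_ℝ = d 2 := fun d => by
    rw [EuclideanSpace.inner_single_right]; simp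
  have hFu1 : ‖F u‖ = 1 := by rw [LinearIsometryEquiv.norm_map, norm_eq_one_of_mem_fccSlots hu]
  have hFu2le : (F u) 2 ≤ 1 := by
    have h1 := abs_apply_sub_le_dist (F u) 0 2
    rw [dist_zero_right, hFu1] at h1
    have : (0 : EuclideanSpace ℝ (Fin 3)) 2 = 0 := rfl
    rw [this, sub_zero] at h1
    exact (abs_le.1 h1).2
  -- the run and its prefix
  obtain ⟨n, hnN, hrun, hInv, hvis, hpre, hend⟩ := hRowRun_prefix hu hu2 N hI
  -- the end pays (via `hRow_end`, which yields the same run)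
  have hH : ∀ p ∈ X, ⟪p, EuclideanSpace.single (2 : Fin 3) (1 : ℝ)⟫_ℝ ≤ h + 2 * R₀ := fun p hp => by
    rw [he₃i]; exact (hcell p hp).2.1
  obtain ⟨n', -, hrun', hyX, hstop, hdeg⟩ := hRow_end hX hu hu2 hcert (r := 3 / 4) (by rw [he₃i]; exact hrise) hH hI
    (N := N) (by rw [he₃i]; exact hN)
  -- heights along the run
  have height : ∀ m : ℕ, (y + (m : ℝ) • F u) 2 = y 2 + m * (F u) 2 := fun m => hRow_height_add_smul y (F u) m
  -- every visited ball is below `h + 2R₀`, so `n ≤ (4/3)(h + 4R₀)`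
  have hn_bound : (n : ℝ) * (3 / 4) ≤ h + 4 * R₀ := by
    have h1 := (hcell _ (hvis n le_rfl)).2.1
    rw [height] at h1
    have hy0 := (hcell y hI.1).1
    nlinarith
  -- lateral radius of every visited ball
  have hlat : ∀ m : ℕ, m ≤ n → Real.sqrt ((y + (m : ℝ) • F u) 0 ^ 2 + (y + (m : ℝ) • F u) 1 ^ 2) ≤ ρ - 4 := by
    intro m hm
    have h1 := sqrt_lateral_add_smul_le y (F u) hFu1 (Nat.cast_nonneg m)
    have h2 : (m : ℝ) ≤ n := by exact_mod_cast hm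
    nlinarith
  by_contra hhigh
  push Not at hhigh
  rw [hrun, height] at hhigh
  -- Case 1: the end is a DEEP PAYER of plate 2 — impossible
  have hρ2 : 2 ≤ ρ := by
    have := hlat 0 (Nat.zero_le _); simp at this; linarith [Real.sqrt_nonneg (y 0 ^ 2 + y 1 ^ 2)]
  have hend_lat := hlat n le_rfl
  have hend_lat2 : (y + (n : ℝ) • F u) 0 ^ 2 + (y + (n : ℝ) • F u) 1 ^ 2 ≤ (ρ - 2) ^ 2 := by
    have h0 : 0 ≤ (y + (n : ℝ) • F u) 0 ^ 2 + (y + (n : ℝ) • F u) 1 ^ 2 := by positivity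
    have h7 := pow_le_pow_left₀ (Real.sqrt_nonneg _) (hend_lat.trans (by linarith : ρ - 4 ≤ ρ - 2)) 2
    rwa [Real.sq_sqrt h0] at h7
  rw [hrun] at hyX hdeg
  have hnotdeep := not_deep_of_card_le_eleven hX hσ₂ L₂ s₂ (h + R₀) (h + 2 * R₀) ρ hρ2 P₂ hP₂X hP₂ hyX hdeg hend_lat2
  rw [height] at hnotdeep
  have htop : h + 2 * R₀ - 1 < y 2 + n * (F u) 2 := by
    by_contra hle; push Not at hle
    exact hnotdeep ⟨by linarith, hle⟩
  -- Case 2: the walker tunnelled through the deep region: the FIRST visited ball at height ≥ h+R₀+2 is non-final and h-full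
  have hex : ∃ m : ℕ, h + R₀ + 2 ≤ y 2 + m * (F u) 2 := ⟨n, by linarith⟩
  set m₀ := Nat.find hex with hm₀
  have hm₀spec : h + R₀ + 2 ≤ y 2 + m₀ * (F u) 2 := Nat.find_spec hex
  have hm₀pos : 0 < m₀ := by
    by_contra h0
    have : m₀ = 0 := by omega
    rw [this] at hm₀spec; simp at hm₀spec; linarith
  have hm₀prev : y 2 + ((m₀ - 1 : ℕ) : ℝ) * (F u) 2 < h + R₀ + 2 := by
    have := Nat.find_min hex (show m₀ - 1 < m₀ by omega)
    push Not at this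
    exact this
  have hm₀lt : y 2 + m₀ * (F u) 2 < h + R₀ + 3 := by
    have : ((m₀ : ℕ) : ℝ) = ((m₀ - 1 : ℕ) : ℝ) + 1 := by
      rw [show (m₀ : ℕ) = (m₀ - 1) + 1 by omega]; push_cast; ring
    rw [this]; nlinarith
  have hm₀n : m₀ < n := by
    by_contra hge; push Not at hge
    have h1 : (n : ℝ) ≤ m₀ := by exact_mod_cast hge
    have h2 : y 2 + n * (F u) 2 ≤ y 2 + m₀ * (F u) 2 := by nlinarith
    linarith
  -- that ball is h-full, in `X`, deep and off the rim: its frame is plate 2's or the twin — contradiction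
  set w := y + (m₀ : ℝ) • F u with hw
  have hwX : w ∈ X := hvis m₀ hm₀n.le
  have hwfull : ∀ s ∈ hcpSlots, w + F s ∈ X := fun s hs => hpre m₀ hm₀n s hs
  have hw2 : h + R₀ + 2 ≤ w 2 := by rw [hw, height]; exact hm₀spec
  have hw2' : w 2 ≤ h + 2 * R₀ - 1 := by rw [hw, height]; linarith
  have hwr : Real.sqrt (w 0 ^ 2 + w 1 ^ 2) ≤ ρ - 3 := (hlat m₀ hm₀n.le).trans (by linarith)
  have hρ3 : 3 ≤ ρ := by
    have := Real.sqrt_nonneg (y 0 ^ 2 + y 1 ^ 2); nlinarith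
  rcases frame_of_hFull_deep hX hσ₂ L₂ s₂ R₀ h ρ hρ3 P₂ hP₂X hP₂ F hwX hwfull hw2 hw2' hwr with h1 | h1
  · exact hapart.1 h1
  · exact hapart.2 h1

/-- **The end of an h-row is not low**: started at height `≥ −2R₀ + 1` off the rim, the end (which is `≥` the start, every step rising) is not at depth `≥ 1`
inside the clamped bottom plate, so it lies `> −R₀ − 1`. -/
theorem hRow_end_not_low (hX : ∀ p ∈ X, ∀ q ∈ X, p ≠ q → 1 ≤ dist p q)
    {σ₁ : ℤ → ℤ} (hσ₁ : IsHaggSeq σ₁) (L₁ : EuclideanSpace ℝ (Fin 3) ≃ₗᵢ[ℝ] EuclideanSpace ℝ (Fin 3)) (s₁ : EuclideanSpace ℝ (Fin 3))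
    (R₀ h ρ : ℝ) (hR₀ : 4 ≤ R₀) (hh : 0 ≤ h) (P₁ : Finset (EuclideanSpace ℝ (Fin 3))) (hP₁X : P₁ ⊆ X)
    (hcell : ∀ p ∈ X, -(2 * R₀) ≤ p 2 ∧ p 2 ≤ h + 2 * R₀ ∧ p 0 ^ 2 + p 1 ^ 2 ≤ ρ ^ 2)
    (hP₁ : ∀ p, p ∈ P₁ ↔ (p ∈ stacking L₁ s₁ σ₁ ∧ -(2 * R₀) ≤ p 2 ∧ p 2 ≤ -R₀ ∧ p 0 ^ 2 + p 1 ^ 2 ≤ ρ ^ 2))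
    {F : EuclideanSpace ℝ (Fin 3) ≃ₗᵢ[ℝ] EuclideanSpace ℝ (Fin 3)} {u : EuclideanSpace ℝ (Fin 3)} (hu : u ∈ fccSlots) (hu2 : u 2 = 0)
    (hrise : (3 / 4 : ℝ) ≤ (F u) 2) (hcert : HStarCertifiedAt F u)
    {y : EuclideanSpace ℝ (Fin 3)} (hI : HRowInv X F u y) (hy1 : -(2 * R₀) + 1 ≤ y 2)
    (hylat : Real.sqrt (y 0 ^ 2 + y 1 ^ 2) + 4 / 3 * (h + 4 * R₀) + 4 ≤ ρ)
    {N : ℕ} (hN : h + 2 * R₀ - y 2 < 3 / 4 * N) :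
    -R₀ - 1 < (hRowRun X F u N y) 2 := by
  classical
  have he₃i : ∀ d : EuclideanSpace ℝ (Fin 3), ⟪d, EuclideanSpace.single (2 : Fin 3) (1 : ℝ)⟫_ℝ = d 2 := fun d => by
    rw [EuclideanSpace.inner_single_right]; simp
  have hFu1 : ‖F u‖ = 1 := by rw [LinearIsometryEquiv.norm_map, norm_eq_one_of_mem_fccSlots hu]
  obtain ⟨n, hnN, hrun, hInv, hvis, -, -⟩ := hRowRun_prefix hu hu2 N hI
  have hH : ∀ p ∈ X, ⟪p, EuclideanSpace.single (2 : Fin 3) (1 : ℝ)⟫_ℝ ≤ h + 2 * R₀ := fun p hp => by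
    rw [he₃i]; exact (hcell p hp).2.1
  obtain ⟨n', -, hrun', hyX, -, hdeg⟩ := hRow_end hX hu hu2 hcert (r := 3 / 4) (by rw [he₃i]; exact hrise) hH hI
    (N := N) (by rw [he₃i]; exact hN)
  have height : ∀ m : ℕ, (y + (m : ℝ) • F u) 2 = y 2 + m * (F u) 2 := fun m => hRow_height_add_smul y (F u) m
  have hn_bound : (n : ℝ) * (3 / 4) ≤ h + 4 * R₀ := by
    have h1 := (hcell _ (hvis n le_rfl)).2.1
    rw [height] at h1
    have hy0 := (hcell y hI.1).1
    nlinarith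
  have hend_lat : Real.sqrt ((y + (n : ℝ) • F u) 0 ^ 2 + (y + (n : ℝ) • F u) 1 ^ 2) ≤ ρ - 4 := by
    have h1 := sqrt_lateral_add_smul_le y (F u) hFu1 (Nat.cast_nonneg n)
    nlinarith
  have hρ2 : 2 ≤ ρ := by
    have := Real.sqrt_nonneg (y 0 ^ 2 + y 1 ^ 2); nlinarith
  have hend_lat2 : (y + (n : ℝ) • F u) 0 ^ 2 + (y + (n : ℝ) • F u) 1 ^ 2 ≤ (ρ - 2) ^ 2 := by
    have h0 : 0 ≤ (y + (n : ℝ) • F u) 0 ^ 2 + (y + (n : ℝ) • F u) 1 ^ 2 := by positivity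
    have h7 := pow_le_pow_left₀ (Real.sqrt_nonneg _) (hend_lat.trans (by linarith : ρ - 4 ≤ ρ - 2)) 2
    rwa [Real.sq_sqrt h0] at h7
  rw [hrun] at hyX hdeg ⊢
  have hnotdeep := not_deep_of_card_le_eleven hX hσ₁ L₁ s₁ (-(2 * R₀)) (-R₀) ρ hρ2 P₁ hP₁X hP₁ hyX hdeg hend_lat2
  rw [height] at hnotdeep ⊢
  have hge : y 2 ≤ y 2 + n * (F u) 2 := by nlinarith
  by_contra hlow; push Not at hlow
  exact hnotdeep ⟨by linarith, by linarith⟩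

end Summit.Ventures.Crystal3D.Theorems

end
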